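import Literature.Geometry.Kaehler.RiemannSurfaceJacobianPullbackIsogeny
import Literature.Geometry.Kaehler.ComplexTorusKleinFourSubgroups
import HarnessLib

/-!
# Kani–Rosen's Theorem A for the Jacobian of a curve: idempotent relations among the `p_H` in `ℚ[G]` give
# isogeny relations among `Jac M` and the Jacobians `Jac(M/H)` of the quotient curves (Paulhus 2008, §2–§3;
# Reyes-Carocca–Rodríguez 2019, Proposition 1)

Layer `Literature/Geometry/Kaehler`, lane `lit-hodgefound` (Track 2, seat p04, generation 53, row g53-#2). Sequel of
`RiemannSurfaceJacobianPullbackIsogeny` (g53-#1: `Jac(M/H) ∼ X^{ε_H}` for `H ≤ G ≤ Aut M`, `ε_H = ρ̄_G(p_H) ∈ End_ℚ(Jac M)`,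
and Theorem B / Theorem C with the actual Jacobians). Here the general engine behind those statements — Paulhus' «Idempotent
relations in `ℚ[G]` lead via the map `e` to idempotent relations in `End⁰(J_X)` […] which translate, through `e` and
Theorem 1, to isogeny relations among `J_X` itself and images of `J_X` under various endomorphisms. By evaluating these
images, we find a decomposition of `J_X`» — is made a theorem about the ACTUAL JACOBIANS of the quotient curves: an identity
`a₀·1 + Σ_i a_i p_{H_i} = b₀·1 + Σ_j b_j p_{K_j}` in `ℚ[G]` gives `Jac(M)^{a₀} × ∏_i Jac(M/H_i)^{a_i} ∼ Jac(M)^{b₀} ×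
∏_j Jac(M/K_j)^{b_j}`, by p10's Hom-count isogeny criterion (`ComplexTorusIdempotentRelations`: two abelian varieties with
the same `dim_ℚ Hom_ℚ(S, ·)` from every simple `S` are isogenous; `dim_ℚ Hom_ℚ(S, X^ε) = χ_S(ε)` is additive in `ε`)
together with `dim_ℚ Hom_ℚ(S, Jac(M/H)) = χ_S(ε_H)` (isogeny invariance of the Hom-counts along `Jac(M/H) ∼ X^{ε_H}`).

J. Paulhus, *Decomposing Jacobians of curves with extra automorphisms*, Acta Arith. 132 (2008), §2 pp. 232–233 (held
`paper:doi-10-4064-aa132-3-3` p0002–p0003), VERBATIM: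

> Given a curve `X` with `G ⊆ Aut(X)`, there is a canonical map of `ℚ`-algebras `e : ℚ[G] → End⁰(J_X) = End(J_X) ⊗_ℤ ℚ`.
> […] **Theorem 1** (Theorem A, [12]). Let `ε_1, …, ε_n, ε'_1, …, ε'_m ∈ End⁰(J_X)` be idempotents. Then the idempotent
> relation `ε_1 + ⋯ + ε_n ∼ ε'_1 + ⋯ + ε'_m` holds in `End⁰(J_X)` if and only if we have the isogeny relation
> `ε_1(J_X) + ⋯ + ε_n(J_X) ∼ ε'_1(J_X) + ⋯ + ε'_m(J_X)`. Idempotent relations in `ℚ[G]` lead via the map `e` to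
> idempotent relations in `End⁰(J_X)`. […] Given a subgroup `H` of `G`, one way to create isogeny relations in `ℚ[G]`
> is to consider relations among the idempotents of the form `ε_H = (1/|H|) Σ_{h ∈ H} h`. In particular, this leads to
> a decomposition of `J_X` in terms of Jacobians of quotient curves `X/H`.

and §3 (p. 234), for `G = ⟨a, b⟩ ≅ V₄`: «(2) `1_G + 2ε_G = ε_{⟨a⟩} + ε_{⟨b⟩} + ε_{⟨ab⟩}` […] (3)
`J_X × J²_{X/⟨a,b⟩} ∼ J_{X/⟨a⟩} × J_{X/⟨b⟩} × J_{X/⟨ab⟩}`».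

S. Reyes-Carocca, R. E. Rodríguez, *A generalisation of Kani–Rosen decomposition theorem for Jacobian varieties*, Ann. Sc.
Norm. Super. Pisa (2019), §1 (held `paper:arxiv-1702.00484` p0003), VERBATIM:

> **Proposition 1.** Let `H_1` and `H_2` be groups of automorphisms of a Riemann surface `C`. Then
> `JC × JC_{⟨H_1, H_2⟩} ∼ JC_{H_1} × JC_{H_2} × P` for some abelian subvariety `P` of `JC`. In particular, if the genus
> of `C_{⟨H_1, H_2⟩}` is zero and `g_C = g_{C_{H_1}} + g_{C_{H_2}}`, then `JC ∼ JC_{H_1} × JC_{H_2}`.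

DICTIONARY (as in g53-#1). `C = X = M` compact connected (in `Type`), `G ≤ Aut M` finite, `H ≤ G` (`Subgroup ↥G`),
`C_H = M/H = OrbitSurface ↥(H.map G.subtype) M` with Jacobian torus `ℂ^{g_H}/Π_H ℤ^{2g_H}` in ANY bases `wH`, `cH`
(`Π_H = periodMatrix (OrbitSurface.mk _ x₀) wH cH`), `J_X = ℂ^g/Π ℤ^{2g}` (`Π = periodMatrix x₀ w c`), `e = ρ̄_G =
groupAlgebraRep ((jacobianRatAction x₀ w c).comp G.subtype) : ℚ[G] → End_ℚ(Jac M)`, `ε_H = ρ̄_G(p_H)`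
(`subgroupIdempotent`), `X^ε = idemPeriod Π ε`, `χ_S = homCharacter S Π` (`χ_S(ε) = dim_ℚ Hom_ℚ(S, X^ε)`), products
`prodPeriod` / `powPeriod` / `sigmaPiPeriod`, `∼` is `IsIsogenous`. UNIVERSES: the Hom-count criterion compares tori
whose ambient complex vector spaces live in ONE universe (its test tori `S` range over that universe), so in §2–§4 the
index types of the bases of holomorphic one-forms (`σ`, `τ i`, …) are taken in a common universe `u₁`.

## What is proved (theorems only; NO definition, NO instance, NO named fact, no `sorry`)

* §0 (torus level) `natCast_finrank_homRat_eq_homCharacter_of_isIsogenous` (`dim_ℚ Hom_ℚ(S, Y) = χ_S(ε)` for `Y ∼ X^ε`).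
* §1 ★ **`isAbelianVariety_jacobian_orbitSurface`** (`Jac(M/H)`, in any presentation, is an abelian variety — through
  `Jac(M/H) ∼ X^{ε_H}`, no real-manifold structure on `M/H` needed), ★ `natCast_finrank_homRat_jacobian_orbitSurface`
  (`dim_ℚ Hom_ℚ(S, Jac(M/H)) = χ_S(ε_H)`),
  ★ `isIsogenous_jacobian_orbitSurface_bot` (`Jac(M/{1}) ∼ Jac M`), ★ `isIsogenous_jacobian_orbitSurface_conj`
  (`Jac(M/gHg⁻¹) ∼ Jac(M/H)`: «conjugate covers»).
* §2 ★★★ **THEOREM A (WITH MULTIPLICITIES) FOR JACOBIANS OF CURVES `isIsogenous_prod_powers_jacobian_orbitSurface_of_sum_smul_eq`**: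
  `a₀·1 + Σ_i a_i p_{H_i} = b₀·1 + Σ_j b_j p_{K_j}` in `ℚ[G]` ⟹ `Jac(M)^{a₀} × ∏_i Jac(M/H_i)^{a_i} ∼ Jac(M)^{b₀} ×
  ∏_j Jac(M/K_j)^{b_j}`.
* §3 ★★ **Paulhus' (3): `isIsogenous_jacobian_prod_sq_orbitSurface_kleinFour`** — `Jac M × Jac(M/G)² ∼ Jac(M/⟨a⟩) ×
  Jac(M/⟨b⟩) × Jac(M/⟨ab⟩)` for `G = ⟨a, b⟩ ≅ V₄ ≤ Aut M` (from (2) `1 + 2p_G = p_{⟨a⟩} + p_{⟨b⟩} + p_{⟨ab⟩}`).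
* §4 ★★ **Reyes-Carocca–Rodríguez' Proposition 1 for a permutable pair `H₁H₂ = H₂H₁`:
  `isIsogenous_jacobian_prod_orbitSurface_sup_of_coe_sup_eq`** — `Jac M × Jac(M/H₁H₂) ∼ Jac(M/H₁) × Jac(M/H₂) × P(H₁, H₂)`
  with `P(H₁, H₂) = X^{ρ̄_G((1 − p_{H₁})(1 − p_{H₂}))}` the Prym variety of the pair (`ComplexTorusPrymOfPair`), from the
  identity `1 + p_{H₁H₂} = p_{H₁} + p_{H₂} + (1 − p_{H₁})(1 − p_{H₂})`; and its «in particular»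
  ★★ **`isIsogenous_prod_jacobian_orbitSurface_pair`** — `g(M/H₁H₂) = 0`, `g = g(M/H₁) + g(M/H₂)` ⟹
  `Jac(M/H₁) × Jac(M/H₂) ∼ Jac M`.

Scope (honest): §4 is stated for PERMUTABLE pairs (`((H₁ ⊔ H₂) : Set) = H₁ * H₂`), the hypothesis under which the tree's
Prym of a pair is defined; Reyes-Carocca–Rodríguez prove Proposition 1 for arbitrary pairs by the dimension formula for
`V₁ + V₂`, which is not reproduced here.

## References

* J. Paulhus, *Decomposing Jacobians of curves with extra automorphisms*, Acta Arith. 132 (2008) 231–244, §2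
  (pp. 232–233: `e : ℚ[G] → End⁰(J_X)`, Theorem 1 = Kani–Rosen's Theorem A, `ε_H`), §3 (2)–(3). [Paulhus2008]
* E. Kani, M. Rosen, *Idempotent relations and factors of Jacobians*, Math. Ann. 284 (1989) 307–327, Theorem A.
  [KaniRosen1989]
* S. Reyes-Carocca, R. E. Rodríguez, *A generalisation of Kani–Rosen decomposition theorem for Jacobian varieties*,
  Ann. Sc. Norm. Super. Pisa Cl. Sci. (5) 19 (2019), §1 Proposition 1. [ReyesCaroccaRodriguez2019]
* H. Lange, R. E. Rodríguez, *Decomposition of Jacobians by Prym Varieties*, LNM 2310, Springer (2022), §3.4 (Prym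
  variety of a pair, Proposition 3.4.4), §3.5.2 Proposition 3.5.7, §5.3.2 Corollary 5.3.5 (proof: conjugate covers).
  [LangeRodriguez2022]
* H. Lange, *Abelian Varieties over the Complex Numbers*, Springer (2023), §2.4.4 Theorem 2.4.25, Corollary 2.4.26;
  §2.1.1 Proposition 2.1.1 (b). [Lange2023AbelianVarietiesComplex]
-/

noncomputable section

open scoped Manifold ContDiff Topology Pointwise
open Set Function Module Submodule Matrix
open Literature.RepresentationTheory.FiniteGroups

namespace Literature.Geometry.Kaehler

/-! ### §0 Torus level: `dim_ℚ Hom_ℚ(S, Y) = χ_S(ε)` for `Y ∼ X^ε` -/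

namespace ComplexTorus

section HomCount

variable {ι : Type*} [Fintype ι] [DecidableEq ι] {E : Type*} [NormedAddCommGroup E] [NormedSpace ℂ E]
  (Φ : (ι → ℝ) ≃L[ℝ] E)
  {ι' : Type*} [Fintype ι'] [DecidableEq ι'] {E' : Type*} [NormedAddCommGroup E'] [NormedSpace ℂ E']
  {Ψ : (ι' → ℝ) ≃L[ℝ] E'}
  {ι₀ : Type*} [Fintype ι₀] [DecidableEq ι₀] {E₀ : Type*} [NormedAddCommGroup E₀] [NormedSpace ℂ E₀]
  (S : (ι₀ → ℝ) ≃L[ℝ] E₀)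

/-- **`dim_ℚ Hom_ℚ(S, Y) = χ_S(ε)` for a torus `Y` isogenous to the image `X^ε` of an idempotent `ε ∈ End_ℚ(X)`** (isogeny
invariance of the Hom-counts and `χ_S(ε) = dim_ℚ Hom_ℚ(S, X^ε)`): the `ℚ`-character of Kani–Rosen's Theorem A evaluated
through an «evaluation of the image» `ε(J_X) ∼ Y`. [cite: Paulhus2008, §2 Theorem 1 (Kani–Rosen's Theorem A) and «By evaluating these images»] [cite: Lange2023AbelianVarietiesComplex, §2.4.4 Corollary 2.4.26 (proof)] -/
theorem natCast_finrank_homRat_eq_homCharacter_of_isIsogenous {A : endAlgRat Φ} (hA : IsIdempotentElem A)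
    (hY : IsIsogenous Ψ (idemPeriod Φ A)) : (finrank ℚ (homRat S Ψ) : ℚ) = homCharacter S Φ A := by
  rw [IsIsogenous.finrank_homRat_eq_right S hY, homCharacter_eq_finrank S Φ hA]

end HomCount

end ComplexTorus

namespace RiemannSurface

open ComplexTorus MeromorphicOneForm

universe u u₁

/-! ### §1 `Jac(M/H)` is an abelian variety; `Jac(M/{1}) ∼ Jac M`; `dim_ℚ Hom_ℚ(S, Jac(M/H)) = χ_S(ε_H)`; conjugate subgroups -/

section Absolute

variable {M : Type u} [TopologicalSpace M] [ChartedSpace ℂ M] [ConnectedSpace M] [IsManifold 𝓘(ℂ, ℂ) ω M]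
  [CompactSpace M] [T2Space M] [IsManifold 𝓘(ℝ, ℂ) ∞ M] [Fact (Module.finrank ℝ ℂ = 2)] [Finite (autGroup M)]
  (x₀ : M) (H : Subgroup (autGroup M)) [Fintype ↥H]
  {σ' : Type*} [Fintype σ'] [DecidableEq σ'] (w' : Module.Basis σ' ℂ ↥(holomorphicOneForms (OrbitSurface ↥H M)))
  {κ' : Type*} [Fintype κ'] [DecidableEq κ'] (c' : Module.Basis κ' ℤ ↥(periods (OrbitSurface.mk ↥H x₀)))

/-- ★ **`Jac(M/H)` is an abelian variety** — in ANY presentation `ℂ^{g_H}/Π_H ℤ^{2g_H}` (bases `w'`, `c'`), WITHOUT a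
real-manifold structure on the orbit surface: it is isogenous to the abelian subvariety `π(Fix_H) = (Jac(M)^H)^0` of the
abelian variety `Jac M` (canonical polarization, in auxiliary bases of `Ω¹(M)` and `Λ`), and «a complex torus isogenous to an
abelian variety is an abelian variety». [cite: LangeRodriguez2022, §3.5.2 Proposition 3.5.7 («`π_H^*(JC_H)` which is of course isogenous to `JC_H`»)] [cite: Lange2023AbelianVarietiesComplex, §2.1.1 Proposition 2.1.1 (b), §4.1.2 Proposition 4.1.2] -/
theorem isAbelianVariety_jacobian_orbitSurface : IsAbelianVariety (periodMatrix (OrbitSurface.mk ↥H x₀) w' c') := by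
  classical
  haveI := moduleFree_int_periods x₀
  haveI := moduleFinite_int_periods x₀
  haveI : Module.Finite ℂ ↥(holomorphicOneForms M) := moduleFinite_holomorphicOneForms (M := M)
  let c := Module.finBasisOfFinrankEq ℤ ↥(periods x₀) (finrank_int_periods x₀)
  let w := Module.finBasis ℂ ↥(holomorphicOneForms M)
  exact (IsIsogenous.isAbelianVariety_iff _ _ (isIsogenous_jacobian_orbitSurface_fixedSubspace x₀ w c H w' c')).2
    (IsAbelianVariety.subtorus _ (isLatticeSubspace_fixedSubspace_jacobianRatAction x₀ w c H)
      (isComplexSubspace_fixedSubspace_jacobianRatAction x₀ w c H) (isAbelianVariety_jacobian w x₀ c))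

variable {σ : Type*} [Fintype σ] [DecidableEq σ] (w : Module.Basis σ ℂ ↥(holomorphicOneForms M))
  {κ : Type*} [Fintype κ] [DecidableEq κ] (c : Module.Basis κ ℤ ↥(periods x₀))
  {σ₁ : Type*} [Fintype σ₁] [DecidableEq σ₁]
  (w₁ : Module.Basis σ₁ ℂ ↥(holomorphicOneForms (OrbitSurface ↥(⊥ : Subgroup (autGroup M)) M)))
  {κ₁ : Type*} [Fintype κ₁] [DecidableEq κ₁] (c₁ : Module.Basis κ₁ ℤ ↥(periods (OrbitSurface.mk ↥(⊥ : Subgroup (autGroup M)) x₀)))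

/-- ★ **`Jac(M/{1}) ∼ Jac M`**: the Jacobian of the trivial quotient (`p_{1} = 1`, `A^{1} = J̃`) is isogenous to `Jac M`
(`Jac(M/{1}) ∼ π(Fix_{1}) = π(Λ ⊗ ℝ) = X^1 ∼ X`). [cite: LangeRodriguez2022, §2.8 Corollary 2.8.4 (`H = {1}`), §3.5.2 Proposition 3.5.7] [cite: Paulhus2008, p. 233 Theorem 2 (the factor `J_X` itself)] -/
theorem isIsogenous_jacobian_orbitSurface_bot [Fintype ↥(⊥ : Subgroup (autGroup M))] :
    IsIsogenous (periodMatrix (OrbitSurface.mk ↥(⊥ : Subgroup (autGroup M)) x₀) w₁ c₁) (periodMatrix x₀ w c) := by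
  refine IsIsogenous.trans _ _ _ (isIsogenous_jacobian_orbitSurface_fixedSubspace x₀ w c ⊥ w₁ c₁)
    (IsIsogenous.trans _ _ _ (isIsogenous_subtorusPeriod_of_eq _ ?_ _ _
      (isLatticeSubspace_idemSubspace _) (isComplexSubspace_idemSubspace (periodMatrix x₀ w c) (1 : endAlgRat _).2))
      ((isAbelianVariety_jacobian w x₀ c).isIsogenous_idemPeriod_one (periodMatrix x₀ w c)))
  rw [fixedSubspace_jacobianRatAction_bot, Subalgebra.coe_one, idemSubspace_one]

end Absolute

section Counts

variable {M : Type} [TopologicalSpace M] [ChartedSpace ℂ M] [ConnectedSpace M] [IsManifold 𝓘(ℂ, ℂ) ω M]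
  [CompactSpace M] [T2Space M] [Finite (autGroup M)]
  (G : Subgroup (autGroup M)) [Fintype ↥G] (x₀ : M)
  {σ : Type*} [Fintype σ] [DecidableEq σ] (w : Module.Basis σ ℂ ↥(holomorphicOneForms M))
  {κ : Type*} [Fintype κ] [DecidableEq κ] (c : Module.Basis κ ℤ ↥(periods x₀))
  (H : Subgroup ↥G) [Fintype ↥(H.map G.subtype)]
  {σ' : Type*} [Fintype σ'] [DecidableEq σ']
  (w' : Module.Basis σ' ℂ ↥(holomorphicOneForms (OrbitSurface ↥(H.map G.subtype) M)))
  {κ' : Type*} [Fintype κ'] [DecidableEq κ'] (c' : Module.Basis κ' ℤ ↥(periods (OrbitSurface.mk ↥(H.map G.subtype) x₀)))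
  {ι₀ : Type*} [Fintype ι₀] [DecidableEq ι₀] {E₀ : Type*} [NormedAddCommGroup E₀] [NormedSpace ℂ E₀]
  (S : (ι₀ → ℝ) ≃L[ℝ] E₀)

/-- ★ **`dim_ℚ Hom_ℚ(S, Jac(M/H)) = χ_S(ε_H)`** for every complex torus `S`: the Hom-count of the quotient Jacobian is the
`ℚ`-character of `Hom_ℚ(S, Jac M)` at `ε_H = ρ̄_G(p_H)` («By evaluating these images»: `ε_H(J_X) ∼ J_{X/H}`).
[cite: Paulhus2008, §2 (Theorem 1 and «a decomposition of `J_X` in terms of Jacobians of quotient curves `X/H`»)] [cite: LangeRodriguez2022, §3.5.2 Proposition 3.5.7] -/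
theorem natCast_finrank_homRat_jacobian_orbitSurface :
    (finrank ℚ (homRat S (periodMatrix (OrbitSurface.mk ↥(H.map G.subtype) x₀) w' c')) : ℚ) =
      homCharacter S (periodMatrix x₀ w c)
        (groupAlgebraRep ((jacobianRatAction x₀ w c).comp G.subtype) (subgroupIdempotent H)) :=
  natCast_finrank_homRat_eq_homCharacter_of_isIsogenous _ S (isIdempotentElem_groupAlgebraRep_subgroupIdempotent _ H)
    (isIsogenous_jacobian_orbitSurface_idemPeriod_rel G x₀ w c H w' c')

variable (g : ↥G) [Fintype ↥((H.map ((MulAut.conj g : ↥G ≃* ↥G) : ↥G →* ↥G)).map G.subtype)]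
  {σ'' : Type*} [Fintype σ''] [DecidableEq σ'']
  (w'' : Module.Basis σ'' ℂ ↥(holomorphicOneForms
    (OrbitSurface ↥((H.map ((MulAut.conj g : ↥G ≃* ↥G) : ↥G →* ↥G)).map G.subtype) M)))
  {κ'' : Type*} [Fintype κ''] [DecidableEq κ'']
  (c'' : Module.Basis κ'' ℤ ↥(periods
    (OrbitSurface.mk ↥((H.map ((MulAut.conj g : ↥G ≃* ↥G) : ↥G →* ↥G)).map G.subtype) x₀)))

/-- ★ **`Jac(M/gHg⁻¹) ∼ Jac(M/H)`** — the Jacobians of the quotients by conjugate subgroups («conjugate covers») are isogenous: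
`ε_{gHg⁻¹} = ρ(g) ε_H ρ(g)⁻¹` (`g p_H g⁻¹ = p_{gHg⁻¹}`) and conjugate idempotents have isogenous images (equal
`ℚ`-characters, `χ_S(uεu⁻¹) = χ_S(ε)`). [cite: LangeRodriguez2022, §5.3.2 Corollary 5.3.5 (proof: «the covers `C_{σ²τ} → C_{K_τ}` and `C_τ → C_{K_τ}` are conjugate»)] [cite: Paulhus2008, §2 Theorem 1] -/
theorem isIsogenous_jacobian_orbitSurface_conj [IsManifold 𝓘(ℝ, ℂ) ∞ M] [Fact (Module.finrank ℝ ℂ = 2)] :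
    IsIsogenous (periodMatrix (OrbitSurface.mk ↥((H.map ((MulAut.conj g : ↥G ≃* ↥G) : ↥G →* ↥G)).map G.subtype) x₀) w'' c'')
      (periodMatrix (OrbitSurface.mk ↥(H.map G.subtype) x₀) w' c') := by
  classical
  -- auxiliary bases of `Ω¹(M)` and `Λ` presenting `Jac M` as the abelian variety `X = ℂ^g/Π ℤ^{2g}`
  haveI := moduleFree_int_periods x₀
  haveI := moduleFinite_int_periods x₀
  haveI : Module.Finite ℂ ↥(holomorphicOneForms M) := moduleFinite_holomorphicOneForms (M := M)
  let c := Module.finBasisOfFinrankEq ℤ ↥(periods x₀) (finrank_int_periods x₀)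
  let w := Module.finBasis ℂ ↥(holomorphicOneForms M)
  have hX := isAbelianVariety_jacobian w x₀ c
  have hε := isIdempotentElem_groupAlgebraRep_subgroupIdempotent ((jacobianRatAction x₀ w c).comp G.subtype) H
  -- `ε_{gHg⁻¹} = u ε_H u⁻¹` for the unit `u = ρ_G(g)` of `End_ℚ(Jac M)`
  have hconj : groupAlgebraRep ((jacobianRatAction x₀ w c).comp G.subtype)
        (subgroupIdempotent (H.map ((MulAut.conj g : ↥G ≃* ↥G) : ↥G →* ↥G))) =
      ↑(((jacobianRatAction x₀ w c).comp G.subtype).toHomUnits g) *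
        groupAlgebraRep ((jacobianRatAction x₀ w c).comp G.subtype) (subgroupIdempotent H) *
        ↑(((jacobianRatAction x₀ w c).comp G.subtype).toHomUnits g)⁻¹ := by
    rw [← conj_subgroupIdempotent, map_mul, map_mul, groupAlgebraRep_of, groupAlgebraRep_of, ← map_inv,
      MonoidHom.coe_toHomUnits, MonoidHom.coe_toHomUnits]
  have hiso : IsIsogenous
      (idemPeriod (periodMatrix x₀ w c) (groupAlgebraRep ((jacobianRatAction x₀ w c).comp G.subtype)
        (subgroupIdempotent (H.map ((MulAut.conj g : ↥G ≃* ↥G) : ↥G →* ↥G)))))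
      (idemPeriod (periodMatrix x₀ w c) (groupAlgebraRep ((jacobianRatAction x₀ w c).comp G.subtype)
        (subgroupIdempotent H))) := by
    have h := hX.isIsogenous_idemPeriod_conj _ hε (((jacobianRatAction x₀ w c).comp G.subtype).toHomUnits g)
    rw [← hconj] at h
    exact h
  exact IsIsogenous.trans _ _ _ (isIsogenous_jacobian_orbitSurface_idemPeriod_rel G x₀ w c _ w'' c'')
    (IsIsogenous.trans _ _ _ hiso
      (IsIsogenous.symm _ _ (isIsogenous_jacobian_orbitSurface_idemPeriod_rel G x₀ w c H w' c')))

end Counts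

/-! ### §2 Theorem A (with multiplicities) for Jacobians of curves -/

section TheoremA

variable {M : Type} [TopologicalSpace M] [ChartedSpace ℂ M] [ConnectedSpace M] [IsManifold 𝓘(ℂ, ℂ) ω M]
  [CompactSpace M] [T2Space M] [IsManifold 𝓘(ℝ, ℂ) ∞ M] [Fact (Module.finrank ℝ ℂ = 2)] [Finite (autGroup M)]
  (G : Subgroup (autGroup M)) [Fintype ↥G] (x₀ : M)
  {σ : Type u₁} [Fintype σ] [DecidableEq σ] (w : Module.Basis σ ℂ ↥(holomorphicOneForms M))
  {κ : Type*} [Fintype κ] [DecidableEq κ] (c : Module.Basis κ ℤ ↥(periods x₀))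

/-- ★★★ **KANI–ROSEN'S THEOREM A, WITH MULTIPLICITIES, FOR THE JACOBIAN OF A CURVE** («Idempotent relations in `ℚ[G]` lead
via the map `e` to idempotent relations in `End⁰(J_X)` […] to isogeny relations among `J_X` itself and images of `J_X`
[…] In particular, this leads to a decomposition of `J_X` in terms of Jacobians of quotient curves `X/H`»): an identity
`a₀·1 + Σ_i a_i p_{H_i} = b₀·1 + Σ_j b_j p_{K_j}` in `ℚ[G]`, `G ≤ Aut M` finite, gives
`Jac(M)^{a₀} × ∏_i Jac(M/H_i)^{a_i} ∼ Jac(M)^{b₀} × ∏_j Jac(M/K_j)^{b_j}` (the quotient Jacobians in any bases). Proof: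
both sides are abelian varieties with the same Hom-counts `a₀ χ_S(1) + Σ_i a_i χ_S(ε_{H_i}) = χ_S(e(lhs)) = χ_S(e(rhs))`
from every complex torus `S`. [cite: Paulhus2008, §2 (Theorem 1 = Kani–Rosen's Theorem A; pp. 232–233)] [cite: KaniRosen1989, Theorem A] [cite: LangeRodriguez2022, §3.5.2 Proposition 3.5.7] -/
theorem isIsogenous_prod_powers_jacobian_orbitSurface_of_sum_smul_eq {m n : ℕ}
    (H : Fin m → Subgroup ↥G) (K : Fin n → Subgroup ↥G)
    [∀ i, Fintype ↥((H i).map G.subtype)] [∀ j, Fintype ↥((K j).map G.subtype)]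
    {a₀ b₀ : ℕ} {a : Fin m → ℕ} {b : Fin n → ℕ}
    (hrel : (a₀ : ℚ) • (1 : MonoidAlgebra ℚ ↥G) + ∑ i, (a i : ℚ) • subgroupIdempotent (H i) =
      (b₀ : ℚ) • (1 : MonoidAlgebra ℚ ↥G) + ∑ j, (b j : ℚ) • subgroupIdempotent (K j))
    {τ : Fin m → Type u₁} [∀ i, Fintype (τ i)] [∀ i, DecidableEq (τ i)]
    (wH : ∀ i, Module.Basis (τ i) ℂ ↥(holomorphicOneForms (OrbitSurface ↥((H i).map G.subtype) M)))
    {κH : Fin m → Type*} [∀ i, Fintype (κH i)] [∀ i, DecidableEq (κH i)]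
    (cH : ∀ i, Module.Basis (κH i) ℤ ↥(periods (OrbitSurface.mk ↥((H i).map G.subtype) x₀)))
    {τ' : Fin n → Type u₁} [∀ j, Fintype (τ' j)] [∀ j, DecidableEq (τ' j)]
    (wK : ∀ j, Module.Basis (τ' j) ℂ ↥(holomorphicOneForms (OrbitSurface ↥((K j).map G.subtype) M)))
    {κK : Fin n → Type*} [∀ j, Fintype (κK j)] [∀ j, DecidableEq (κK j)]
    (cK : ∀ j, Module.Basis (κK j) ℤ ↥(periods (OrbitSurface.mk ↥((K j).map G.subtype) x₀))) :
    IsIsogenous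
      (prodPeriod (powPeriod (periodMatrix x₀ w c) a₀)
        (sigmaPiPeriod fun i ↦ powPeriod (periodMatrix (OrbitSurface.mk ↥((H i).map G.subtype) x₀) (wH i) (cH i)) (a i)))
      (prodPeriod (powPeriod (periodMatrix x₀ w c) b₀)
        (sigmaPiPeriod fun j ↦ powPeriod (periodMatrix (OrbitSurface.mk ↥((K j).map G.subtype) x₀) (wK j) (cK j)) (b j))) := by
  have hX := isAbelianVariety_jacobian w x₀ c
  have hH := fun i ↦ isAbelianVariety_jacobian_orbitSurface x₀ _ (wH i) (cH i)
  have hK := fun j ↦ isAbelianVariety_jacobian_orbitSurface x₀ _ (wK j) (cK j)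
  refine ((hX.pow _).prod (IsAbelianVariety.sigmaPi fun i ↦ (hH i).pow _)).isIsogenous_of_forall_finrank_homRat_eq
    ((hX.pow _).prod (IsAbelianVariety.sigmaPi fun j ↦ (hK j).pow _)) fun k E₀ _ _ S _ ↦ ?_
  have key := congrArg (fun z ↦ homCharacter S (periodMatrix x₀ w c)
    (groupAlgebraRep ((jacobianRatAction x₀ w c).comp G.subtype) z)) hrel
  simp only [map_add, map_sum, map_smul, map_one, smul_eq_mul] at key
  rw [homCharacter_one] at key
  simp_rw [← natCast_finrank_homRat_jacobian_orbitSurface G x₀ w c _ (wH _) (cH _) S,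
    ← natCast_finrank_homRat_jacobian_orbitSurface G x₀ w c _ (wK _) (cK _) S] at key
  rw [finrank_homRat_prod_right, finrank_homRat_prod_right, finrank_homRat_powPeriod_right,
    finrank_homRat_powPeriod_right, finrank_homRat_powers_right, finrank_homRat_powers_right]
  exact_mod_cast key

end TheoremA

/-! ### §3 Paulhus' (3) for the Klein four-group: `Jac M × Jac(M/G)² ∼ Jac(M/⟨a⟩) × Jac(M/⟨b⟩) × Jac(M/⟨ab⟩)` -/

section KleinFour

variable {M : Type} [TopologicalSpace M] [ChartedSpace ℂ M] [ConnectedSpace M] [IsManifold 𝓘(ℂ, ℂ) ω M]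
  [CompactSpace M] [T2Space M] [IsManifold 𝓘(ℝ, ℂ) ∞ M] [Fact (Module.finrank ℝ ℂ = 2)] [Finite (autGroup M)]
  (G : Subgroup (autGroup M)) [Fintype ↥G] (x₀ : M)
  {σ : Type u₁} [Fintype σ] [DecidableEq σ] (w : Module.Basis σ ℂ ↥(holomorphicOneForms M))
  {κ : Type*} [Fintype κ] [DecidableEq κ] (c : Module.Basis κ ℤ ↥(periods x₀))
  {σG : Type u₁} [Fintype σG] [DecidableEq σG] (wG : Module.Basis σG ℂ ↥(holomorphicOneForms (OrbitSurface ↥G M)))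
  {κG : Type*} [Fintype κG] [DecidableEq κG] (cG : Module.Basis κG ℤ ↥(periods (OrbitSurface.mk ↥G x₀)))

omit [IsManifold 𝓘(ℝ, ℂ) ∞ M] [Fact (Module.finrank ℝ ℂ = 2)] in
/-- **`dim_ℚ Hom_ℚ(S, Jac(M/G)) = χ_S(ε_G)`**, `ε_G = ρ̄_G(p_G)`. [cite: Paulhus2008, §2 («`ε_H = (1/|H|) Σ_{h ∈ H} h`», `H = G`), §3 (2)] [cite: LangeRodriguez2022, §3.5.2 (3.13)] -/
theorem natCast_finrank_homRat_jacobian_orbitSurface_top {ι₀ : Type*} [Fintype ι₀] [DecidableEq ι₀] {E₀ : Type*}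
    [NormedAddCommGroup E₀] [NormedSpace ℂ E₀] (S : (ι₀ → ℝ) ≃L[ℝ] E₀) :
    (finrank ℚ (homRat S (periodMatrix (OrbitSurface.mk ↥G x₀) wG cG)) : ℚ) =
      homCharacter S (periodMatrix x₀ w c)
        (groupAlgebraRep ((jacobianRatAction x₀ w c).comp G.subtype) (subgroupIdempotent ⊤)) := by
  rw [groupAlgebraRep_subgroupIdempotent_top]
  exact natCast_finrank_homRat_eq_homCharacter_of_isIsogenous _ S (isIdempotentElem_groupAverage _)
    (isIsogenous_jacobian_orbitSurface_idemPeriod_groupAverage G x₀ w c wG cG)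

/-- ★★ **PAULHUS' (3): `Jac M × Jac(M/G)² ∼ Jac(M/⟨a⟩) × Jac(M/⟨b⟩) × Jac(M/⟨ab⟩)`** for a Klein four-group
`G = ⟨a, b⟩ = {1, a, b, ab} ≤ Aut M` — the isogeny relation of the idempotent relation (2)
`1_G + 2ε_G = ε_{⟨a⟩} + ε_{⟨b⟩} + ε_{⟨ab⟩}` of `ℚ[G]` (`sum_subgroupIdempotent_kleinFour`), with every image evaluated as the
Jacobian of the quotient curve; `kleinFourSubgroups a b = (⟨a⟩, ⟨b⟩, ⟨ab⟩)`.
[cite: Paulhus2008, §3 (2)–(3) («`J_X × J²_{X/⟨a,b⟩} ∼ J_{X/⟨a⟩} × J_{X/⟨b⟩} × J_{X/⟨ab⟩}`»)] [cite: KaniRosen1989, Theorem A] -/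
theorem isIsogenous_jacobian_prod_sq_orbitSurface_kleinFour [IsKleinFour ↥G] {x y : ↥G} (hx : x ≠ 1) (hy : y ≠ 1)
    (hxy : x ≠ y) [∀ i, Fintype ↥((kleinFourSubgroups x y i).map G.subtype)]
    {τ : Fin 3 → Type u₁} [∀ i, Fintype (τ i)] [∀ i, DecidableEq (τ i)]
    (wH : ∀ i, Module.Basis (τ i) ℂ ↥(holomorphicOneForms (OrbitSurface ↥((kleinFourSubgroups x y i).map G.subtype) M)))
    {κH : Fin 3 → Type*} [∀ i, Fintype (κH i)] [∀ i, DecidableEq (κH i)]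
    (cH : ∀ i, Module.Basis (κH i) ℤ ↥(periods (OrbitSurface.mk ↥((kleinFourSubgroups x y i).map G.subtype) x₀))) :
    IsIsogenous
      (prodPeriod (periodMatrix x₀ w c) (powPeriod (periodMatrix (OrbitSurface.mk ↥G x₀) wG cG) 2))
      (sigmaPiPeriod fun i : Fin 3 ↦
        periodMatrix (OrbitSurface.mk ↥((kleinFourSubgroups x y i).map G.subtype) x₀) (wH i) (cH i)) := by
  have hX := isAbelianVariety_jacobian w x₀ c
  have hG := (IsIsogenous.isAbelianVariety_iff _ _
    (isIsogenous_jacobian_orbitSurface_idemPeriod_groupAverage G x₀ w c wG cG)).2 (isAbelianVariety_idemPeriod _ hX _)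
  have hH := fun i ↦ isAbelianVariety_jacobian_orbitSurface x₀ _ (wH i) (cH i)
  refine (hX.prod (hG.pow _)).isIsogenous_of_forall_finrank_homRat_eq (IsAbelianVariety.sigmaPi hH)
    fun k E₀ _ _ S _ ↦ ?_
  -- (2): `p_{⟨a⟩} + p_{⟨b⟩} + p_{⟨ab⟩} = 1 + 2 p_G` in `ℚ[G]`, through `χ_S ∘ ρ̄_G`
  have key := congrArg (fun z ↦ homCharacter S (periodMatrix x₀ w c)
    (groupAlgebraRep ((jacobianRatAction x₀ w c).comp G.subtype) z)) (sum_subgroupIdempotent_kleinFour hx hy hxy)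
  simp only [map_add, map_smul, map_one, smul_eq_mul] at key
  rw [homCharacter_one, ← natCast_finrank_homRat_jacobian_orbitSurface_top G x₀ w c wG cG S] at key
  -- the three quotient Jacobians, read against `p_{⟨x⟩}`, `p_{⟨y⟩}`, `p_{⟨xy⟩}` (`kleinFourSubgroups x y i` unfolds to these)
  have h0 : (finrank ℚ (homRat S (periodMatrix (OrbitSurface.mk ↥((kleinFourSubgroups x y 0).map G.subtype) x₀)
      (wH 0) (cH 0))) : ℚ) = homCharacter S (periodMatrix x₀ w c)
        (groupAlgebraRep ((jacobianRatAction x₀ w c).comp G.subtype) (subgroupIdempotent (Subgroup.zpowers x))) :=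
    natCast_finrank_homRat_jacobian_orbitSurface G x₀ w c (kleinFourSubgroups x y 0) (wH 0) (cH 0) S
  have h1 : (finrank ℚ (homRat S (periodMatrix (OrbitSurface.mk ↥((kleinFourSubgroups x y 1).map G.subtype) x₀)
      (wH 1) (cH 1))) : ℚ) = homCharacter S (periodMatrix x₀ w c)
        (groupAlgebraRep ((jacobianRatAction x₀ w c).comp G.subtype) (subgroupIdempotent (Subgroup.zpowers y))) :=
    natCast_finrank_homRat_jacobian_orbitSurface G x₀ w c (kleinFourSubgroups x y 1) (wH 1) (cH 1) S
  have h2 : (finrank ℚ (homRat S (periodMatrix (OrbitSurface.mk ↥((kleinFourSubgroups x y 2).map G.subtype) x₀)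
      (wH 2) (cH 2))) : ℚ) = homCharacter S (periodMatrix x₀ w c)
        (groupAlgebraRep ((jacobianRatAction x₀ w c).comp G.subtype) (subgroupIdempotent (Subgroup.zpowers (x * y)))) :=
    natCast_finrank_homRat_jacobian_orbitSurface G x₀ w c (kleinFourSubgroups x y 2) (wH 2) (cH 2) S
  rw [finrank_homRat_prod_right, finrank_homRat_powPeriod_right, finrank_homRat_sigmaPiPeriod_right, Fin.sum_univ_three]
  rw [← h0, ← h1, ← h2] at key
  exact_mod_cast key.symm

end KleinFour

/-! ### §4 Reyes-Carocca–Rodríguez' Proposition 1 for a permutable pair `H₁H₂ = H₂H₁` -/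

section Pair

variable {M : Type} [TopologicalSpace M] [ChartedSpace ℂ M] [ConnectedSpace M] [IsManifold 𝓘(ℂ, ℂ) ω M]
  [CompactSpace M] [T2Space M] [IsManifold 𝓘(ℝ, ℂ) ∞ M] [Fact (Module.finrank ℝ ℂ = 2)] [Finite (autGroup M)]
  (G : Subgroup (autGroup M)) [Fintype ↥G] (x₀ : M)
  {σ : Type u₁} [Fintype σ] [DecidableEq σ] (w : Module.Basis σ ℂ ↥(holomorphicOneForms M))
  {κ : Type*} [Fintype κ] [DecidableEq κ] (c : Module.Basis κ ℤ ↥(periods x₀))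
  {H₁ H₂ : Subgroup ↥G} (hperm : ((H₁ ⊔ H₂ : Subgroup ↥G) : Set ↥G) = (H₁ : Set ↥G) * (H₂ : Set ↥G))
  [Fintype ↥(H₁.map G.subtype)] [Fintype ↥(H₂.map G.subtype)] [Fintype ↥((H₁ ⊔ H₂).map G.subtype)]
  {σ₁ : Type u₁} [Fintype σ₁] [DecidableEq σ₁]
  (w₁ : Module.Basis σ₁ ℂ ↥(holomorphicOneForms (OrbitSurface ↥(H₁.map G.subtype) M)))
  {κ₁ : Type*} [Fintype κ₁] [DecidableEq κ₁] (c₁ : Module.Basis κ₁ ℤ ↥(periods (OrbitSurface.mk ↥(H₁.map G.subtype) x₀)))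
  {σ₂ : Type u₁} [Fintype σ₂] [DecidableEq σ₂]
  (w₂ : Module.Basis σ₂ ℂ ↥(holomorphicOneForms (OrbitSurface ↥(H₂.map G.subtype) M)))
  {κ₂ : Type*} [Fintype κ₂] [DecidableEq κ₂] (c₂ : Module.Basis κ₂ ℤ ↥(periods (OrbitSurface.mk ↥(H₂.map G.subtype) x₀)))
  {σ₁₂ : Type u₁} [Fintype σ₁₂] [DecidableEq σ₁₂]
  (w₁₂ : Module.Basis σ₁₂ ℂ ↥(holomorphicOneForms (OrbitSurface ↥((H₁ ⊔ H₂).map G.subtype) M)))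
  {κ₁₂ : Type*} [Fintype κ₁₂] [DecidableEq κ₁₂]
  (c₁₂ : Module.Basis κ₁₂ ℤ ↥(periods (OrbitSurface.mk ↥((H₁ ⊔ H₂).map G.subtype) x₀)))

include hperm in
/-- ★★ **PROPOSITION 1 (Reyes-Carocca–Rodríguez) FOR A PERMUTABLE PAIR: `Jac M × Jac(M/H₁H₂) ∼ Jac(M/H₁) × Jac(M/H₂) × P(H₁, H₂)`**,
`P(H₁, H₂) = X^{ρ̄_G((1 − p_{H₁})(1 − p_{H₂}))}` the Prym variety of the pair (`ComplexTorusPrymOfPair`; Lange–Rodríguez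
§3.4) — the isogeny relation of the identity `1 + p_{H₁H₂} = p_{H₁} + p_{H₂} + (1 − p_{H₁})(1 − p_{H₂})` of `ℚ[G]`
(`pair_idempotent_eq`), valid when `H₁H₂ = H₂H₁` (`= ⟨H₁, H₂⟩`). [cite: ReyesCaroccaRodriguez2019, §1 Proposition 1 («`JC × JC_{⟨H_1, H_2⟩} ∼ JC_{H_1} × JC_{H_2} × P`»)] [cite: LangeRodriguez2022, §3.4 Proposition 3.4.2 (the isogenies `k₂^* h₂^* J × k₂^* P(h₂) × k₁^* P(h₁) × P(k₁, k₂) → J̃`)] [cite: Paulhus2008, §2 Theorem 1] -/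
theorem isIsogenous_jacobian_prod_orbitSurface_sup_of_coe_sup_eq :
    IsIsogenous
      (prodPeriod (periodMatrix x₀ w c) (periodMatrix (OrbitSurface.mk ↥((H₁ ⊔ H₂).map G.subtype) x₀) w₁₂ c₁₂))
      (prodPeriod (periodMatrix (OrbitSurface.mk ↥(H₁.map G.subtype) x₀) w₁ c₁)
        (prodPeriod (periodMatrix (OrbitSurface.mk ↥(H₂.map G.subtype) x₀) w₂ c₂)
          (idemPeriod (periodMatrix x₀ w c) (groupAlgebraRep ((jacobianRatAction x₀ w c).comp G.subtype)
            ((1 - subgroupIdempotent H₁) * (1 - subgroupIdempotent H₂)))))) := by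
  have hX := isAbelianVariety_jacobian w x₀ c
  have hq := isIdempotentElem_groupAlgebraRep_pair ((jacobianRatAction x₀ w c).comp G.subtype) hperm
  refine (hX.prod (isAbelianVariety_jacobian_orbitSurface x₀ _ w₁₂ c₁₂)).isIsogenous_of_forall_finrank_homRat_eq
    ((isAbelianVariety_jacobian_orbitSurface x₀ _ w₁ c₁).prod
      ((isAbelianVariety_jacobian_orbitSurface x₀ _ w₂ c₂).prod (isAbelianVariety_idemPeriod _ hX _)))
    fun k E₀ _ _ S _ ↦ ?_
  -- `1 + p_N = p_{H₁} + p_{H₂} + q` in `ℚ[G]`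
  have hrel : (1 : MonoidAlgebra ℚ ↥G) + subgroupIdempotent (H₁ ⊔ H₂) =
      subgroupIdempotent H₁ + subgroupIdempotent H₂ + (1 - subgroupIdempotent H₁) * (1 - subgroupIdempotent H₂) := by
    rw [pair_idempotent_eq hperm]
    abel
  have key := congrArg (fun z ↦ homCharacter S (periodMatrix x₀ w c)
    (groupAlgebraRep ((jacobianRatAction x₀ w c).comp G.subtype) z)) hrel
  simp only [map_add, map_one] at key
  rw [homCharacter_one, ← natCast_finrank_homRat_jacobian_orbitSurface G x₀ w c _ w₁₂ c₁₂ S,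
    ← natCast_finrank_homRat_jacobian_orbitSurface G x₀ w c _ w₁ c₁ S,
    ← natCast_finrank_homRat_jacobian_orbitSurface G x₀ w c _ w₂ c₂ S, homCharacter_eq_finrank S _ hq, add_assoc] at key
  rw [finrank_homRat_prod_right, finrank_homRat_prod_right, finrank_homRat_prod_right]
  exact_mod_cast key

omit [Fintype ↥((H₁ ⊔ H₂).map G.subtype)] in
include hperm in
/-- ★★ **«In particular, if the genus of `C_{⟨H_1, H_2⟩}` is zero and `g_C = g_{C_{H_1}} + g_{C_{H_2}}`, then
`JC ∼ JC_{H_1} × JC_{H_2}`»** (for a permutable pair): then `ε_{H₁H₂} = 0` and the Prym of the pair has dimension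
`g − g(M/H₁) − g(M/H₂) + g(M/H₁H₂) = 0`, so `ε_{H₁} + ε_{H₂} = 1` and the Hom-counts of `Jac(M/H₁) × Jac(M/H₂)` and `Jac M`
agree. [cite: ReyesCaroccaRodriguez2019, §1 Proposition 1 («In particular …»)] [cite: LangeRodriguez2022, §3.4 Proposition 3.4.4 («`dim P(k₁, k₂) = g(C̃) − g(C₂) − g(C₁) + g(C)`»)] [cite: KaniRosen1989, Theorem C (`t = 2`)] -/
theorem isIsogenous_prod_jacobian_orbitSurface_pair (h0 : arithGenus (OrbitSurface ↥((H₁ ⊔ H₂).map G.subtype) M) = 0)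
    (hsum : arithGenus M = arithGenus (OrbitSurface ↥(H₁.map G.subtype) M) + arithGenus (OrbitSurface ↥(H₂.map G.subtype) M)) :
    IsIsogenous
      (prodPeriod (periodMatrix (OrbitSurface.mk ↥(H₁.map G.subtype) x₀) w₁ c₁)
        (periodMatrix (OrbitSurface.mk ↥(H₂.map G.subtype) x₀) w₂ c₂))
      (periodMatrix x₀ w c) := by
  classical
  set ρ := (jacobianRatAction x₀ w c).comp G.subtype with hρ
  have hX := isAbelianVariety_jacobian w x₀ c
  -- `ε_N = 0` (`g(M/N) = 0`)
  have hN : groupAlgebraRep ρ (subgroupIdempotent (H₁ ⊔ H₂)) = 0 :=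
    (groupAlgebraRep_subgroupIdempotent_jacobian_eq_zero_iff G x₀ w c (H₁ ⊔ H₂)).2 h0
  -- the Prym of the pair is `0`: its lattice has rank `2g − 2g₁ − 2g₂ + 2g_N = 0`
  have hq0 : groupAlgebraRep ρ ((1 - subgroupIdempotent H₁) * (1 - subgroupIdempotent H₂)) = 0 := by
    have hrk := subRank_idemSubspace_pair_eq (Φ := periodMatrix x₀ w c) ρ hperm
    rw [subRank_idemSubspace_subgroupIdempotent_jacobian G x₀ w c H₁,
      subRank_idemSubspace_subgroupIdempotent_jacobian G x₀ w c H₂,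
      subRank_idemSubspace_subgroupIdempotent_jacobian G x₀ w c (H₁ ⊔ H₂), h0,
      fintypeCard_eq_two_mul_arithGenus x₀ c, hsum] at hrk
    push_cast at hrk
    have hrk0 : subRank (idemSubspace ((groupAlgebraRep ρ ((1 - subgroupIdempotent H₁) * (1 - subgroupIdempotent H₂)) :
        endAlgRat (periodMatrix x₀ w c)) : Matrix κ κ ℚ)) = 0 := by
      exact_mod_cast (show (subRank (idemSubspace ((groupAlgebraRep ρ ((1 - subgroupIdempotent H₁) *
        (1 - subgroupIdempotent H₂)) : endAlgRat (periodMatrix x₀ w c)) : Matrix κ κ ℚ)) : ℚ) = 0 by rw [hrk]; ring)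
    have hbot : idemSubspace ((groupAlgebraRep ρ ((1 - subgroupIdempotent H₁) * (1 - subgroupIdempotent H₂)) :
        endAlgRat (periodMatrix x₀ w c)) : Matrix κ κ ℚ) = ⊥ := by
      rw [← Submodule.finrank_eq_zero, finrank_eq_subRank (isLatticeSubspace_idemSubspace _), hrk0]
    exact ZeroMemClass.coe_eq_zero.1 (eq_zero_of_idemSubspace_eq_bot hbot)
  -- hence `ε_{H₁} + ε_{H₂} = 1`
  have hsum1 : groupAlgebraRep ρ (subgroupIdempotent H₁) + groupAlgebraRep ρ (subgroupIdempotent H₂) = 1 := by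
    have h := congrArg (groupAlgebraRep ρ) (pair_idempotent_eq (G := ↥G) hperm)
    rw [hq0, map_add, map_sub, map_sub, map_one, hN, add_zero, eq_comm, sub_sub, sub_eq_zero] at h
    exact h.symm
  refine ((isAbelianVariety_jacobian_orbitSurface x₀ _ w₁ c₁).prod
    (isAbelianVariety_jacobian_orbitSurface x₀ _ w₂ c₂)).isIsogenous_of_forall_finrank_homRat_eq hX
    fun k E₀ _ _ S _ ↦ ?_
  have key := congrArg (homCharacter S (periodMatrix x₀ w c)) hsum1
  rw [map_add, ← natCast_finrank_homRat_jacobian_orbitSurface G x₀ w c _ w₁ c₁ S,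
    ← natCast_finrank_homRat_jacobian_orbitSurface G x₀ w c _ w₂ c₂ S, homCharacter_one] at key
  rw [finrank_homRat_prod_right]
  exact_mod_cast key

end Pair

end RiemannSurface

end Literature.Geometry.Kaehler
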